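import Literature.Probability.LatticeModels.LeeYangFirstZeroLimitProofs
import Literature.Probability.LatticeModels.UrsellFirstZeroProofs
import Literature.Probability.LatticeModels.IsingTransport
import HarnessLib

/-!
# Thermodynamic limit of the first Lee–Yang zero — the subcritical direction from the monotonicity of Ursell functions

Topic `Probability/LatticeModels`, namespace `Literature.Probability.LatticeModels.JiangNewman`.
Second sibling PROOF file of `LeeYangFirstZeroLimit.lean` (the named fact `JiangNewman.FirstZeroLimit`
= J. Jiang, C. M. Newman, *Thermodynamic limit of the first Lee–Yang zero*, CPAM 77 (2024),
arXiv:2210.03602 [JiangNewman2023], Thm. 1 with Props. 1–3 and Lemma 1, for the boxes `B_n`), after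
`LeeYangFirstZeroLimitProofs.lean`. That file reduced the fact (`firstZeroLimit_of_CJN_of_residual`)
to the named fact `CamiaJiangNewman2023_thm2` and two analytic inputs at `0 ≤ β < β_c(d)`:
(ii) the positivity of `a = lim_n α₁(B_n, β)` and (iii) "`f_β` extends to no disc of radius `> a`"
together with JN (2.23), `1/a ≤ limsup_k [|f_β^{(2k)}(0)|/(2k)!]^{1/(2k)}`. Here we PROVE (iii) from
Camia–Jiang–Newman 2023, Theorem 1 (the tree's named fact `CamiaJiangNewman2023_thm1`, monotonicity
of Ursell functions) and (ii), following the printed route of Jiang–Newman §2 (proof of Prop. 1,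
eqs. (2.7)–(2.9), and (2.22)–(2.23)) read in finite volume:

* `partitionFunction_union_of_separated`, `partitionFunction_shift` — `Z_{Λ₁∪Λ₂} = Z_{Λ₁}Z_{Λ₂}`
  for disjoint volumes with no edge of `ℤ^d` between them, and translation invariance of
  `Z_{Λ,β,h}` (transport along `IsingTransport.edgesIn_map` / `glue_map_free`).
* `magnetizationCumulant_eq_cumulantOf` — DICTIONARY: the cumulants `u_n(M_{Λ,β,0})` of the fact
  file (`h`-derivatives of `ln Z_{Λ,β,h}` at `0`, JN (2.2)–(2.3)) are the cumulants `cumulantOf` of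
  the moments `⟨M_Λ^m⟩` under the pair-interaction average `PairIsing.avg` with the couplings of `Λ`
  (`Z_{Λ,β,h}/Z_{Λ,β,0}` is the moment generating function `PairIsing.mgf`, and
  `CumulantsAnalytic.iteratedDeriv_succ_eq_cumulantOf`).
* `cumulantOf_eq_add_of_mgf_eq_mul`, `mgf_couplingOfSubset_eq_mul`, `cumulantOf_couplingOfSubset` —
  cumulants add over independent systems; with the couplings of `Λ₀ ⊆ Λ` read on the sites of `Λ`
  the model is `Λ₀` plus the free spins of `Λ ∖ Λ₀`, so its `n`-th cumulant is
  `u_n(M_{Λ₀}) + κ_n(free spins)`, the latter of Shlosman's sign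
  (`PairIsing.cumulant_weightedMagnetization_zero_coupling_nonneg`).
* `magnetizationCumulant_mono_of_thm1`, `abs_magnetizationCumulant_mono_of_thm1` — **volume
  monotonicity `|u_{2k}(M_{Λ₀})| ≤ |u_{2k}(M_Λ)|` for `Λ₀ ⊆ Λ`, given CJN Thm 1** (raising the
  couplings raises `(-1)^{k-1}κ_{2k}`, `cumulant_weightedMagnetization_mono_of_thm1`); Shlosman's
  sign `(-1)^{k-1}u_{2k}(M_Λ) ≥ 0` (`magnetizationCumulant_sign_of_thm1`).
* `partitionFunction_biUnion_tile`, `card_mul_abs_magnetizationCumulant_le_of_thm1` — the box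
  `B_{(2n+2)r+n}` contains the `(2r+1)^d` pairwise separated translates `B_n + (2n+2)t`, `t ∈ B_r`,
  whence `(2r+1)^d |u_{2k}(M_{B_n})| ≤ |u_{2k}(M_{B_{(2n+2)r+n}})|` (JN (2.9) in finite volume).
* `abs_magnetizationCumulant_le_of_thm1` — with the convergence of the cumulant densities
  (`tendsto_magnetizationCumulant_div_card`, granted `a > 0`): `(2n+2)^{-d}|u_{2k}(M_{B_n})| ≤ |f_β^{(2k)}(0)|`.
* `inv_le_limsup_of_thm1` — **JN (2.23)**: `1/a ≤ limsup_k [|f_β^{(2k)}(0)|/(2k)!]^{1/(2k)}` (through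
  JN (2.22), `inv_firstZero_eq_limsup`, the constant `(2n+2)^{-d/(2k)} → 1` disappearing under the root).
* `not_analyticOnDisc_of_thm1` — no holomorphic extension of `f_β` to a disc of radius `> a`
  (Cauchy's estimates against (2.23)).
* `firstZeroLimit_of_thm1_of_pos` — **`FirstZeroLimit` from `CamiaJiangNewman2023_thm1` and the
  positivity (ii)** (with the tree's `CamiaJiangNewman2023_thm2_of_thm1` for the antitonicity).
* `le_firstZero_of_thm1_of_analyticOnDisc`, `firstZeroLimit_of_thm1_of_analytic_of_tendsto` — the
  positivity (ii) itself from the two PRINTED inputs of JN Prop. 3: a holomorphic extension of `f_β`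
  to some disc `|h| < ρ` [Ott 2020, Cor. 1.4] and the convergence of the even cumulant densities to
  `f_β^{(2k)}(0)` [JN Thm. 2 = Lebowitz 1972 + ABF 1987]: then `α₁(B_n, β) ≥ ρ` for every `n`
  (JN Cor. 1), so `FirstZeroLimit` follows from CJN Thm 1 + Ott Cor. 1.4 + JN Thm. 2 exactly as printed.

What is NOT proved here (stated as hypotheses): CJN Thm 1 (the tree's named fact), and for
`d ≥ 2`, `0 ≤ β < β_c(d)` either the positivity `lim_n α₁(B_n,β) > 0` (`hpos`, JN Cor. 1) or its two
printed sources, the analyticity of `f_β` at `h = 0` [Ott 2020, Cor. 1.4] (`hOtt`) and the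
convergence of the cumulant densities [Lebowitz 1972 / Aizenman–Barsky–Fernández 1987, JN Thm. 2]
(`hLeb`); neither of the latter is in the tree. No definitions, no named facts; everything is a theorem.

## References

* [JiangNewman2023] J. Jiang, C. M. Newman, CPAM 77 (2024) 1224–1234, arXiv:2210.03602: Thm. 1,
  Prop. 1 (proof, eqs. (2.5)–(2.9)), Prop. 2 (eqs. (2.22)–(2.27)), Prop. 3, Cor. 1.
* [CamiaJiangNewman2023] F. Camia, J. Jiang, C. M. Newman, CMP 401 (2023), arXiv:2207.12247:
  Thm 1, Remark 1 (Shlosman's signs), §1.2 eq. (14).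
* [Ott2019] S. Ott, CMP 377 (2020) 675–696, Cor. 1.4 (the missing input (ii)).
-/

noncomputable section

open Filter Topology Finset Complex

namespace Literature.Probability.LatticeModels

namespace JiangNewman

variable {d : ℕ}

/-! ### Factorisation of `Z_{Λ₁ ∪ Λ₂}` for separated volumes -/

section Separated

/-- The edges inside a union of two SEPARATED volumes (no nearest-neighbour pair across) are the
edges inside the parts. [folklore] -/
theorem edgesIn_union_of_separated {Λ₁ Λ₂ : Finset (Site d)}
    (hsep : ∀ x ∈ Λ₁, ∀ y ∈ Λ₂, ¬ (zdGraph d).Adj x y) :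
    edgesIn (zdGraph d) (Λ₁ ∪ Λ₂) = edgesIn (zdGraph d) Λ₁ ∪ edgesIn (zdGraph d) Λ₂ := by
  ext e
  simp only [Finset.mem_union, mem_edgesIn_iff]
  constructor
  · rintro ⟨he, hmem⟩
    induction e using Sym2.ind with
    | _ a b =>
      have hadj : (zdGraph d).Adj a b := (SimpleGraph.mem_edgeSet _).1 he
      have ha := hmem a (Sym2.mem_mk_left a b)
      have hb := hmem b (Sym2.mem_mk_right a b)
      rcases ha with ha | ha <;> rcases hb with hb | hb
      · exact Or.inl ⟨he, fun x hx => by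
          rcases Sym2.mem_iff.1 hx with rfl | rfl <;> assumption⟩
      · exact absurd hadj (hsep a ha b hb)
      · exact absurd hadj.symm (hsep b hb a ha)
      · exact Or.inr ⟨he, fun x hx => by
          rcases Sym2.mem_iff.1 hx with rfl | rfl <;> assumption⟩
  · rintro (⟨he, hmem⟩ | ⟨he, hmem⟩)
    · exact ⟨he, fun x hx => Or.inl (hmem x hx)⟩
    · exact ⟨he, fun x hx => Or.inr (hmem x hx)⟩

/-- Separated volumes are disjoint as soon as they are — trivially — assumed disjoint; we record
that their inside-edge sets are disjoint. [folklore] -/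
theorem disjoint_edgesIn_of_disjoint {Λ₁ Λ₂ : Finset (Site d)} (hdis : Disjoint Λ₁ Λ₂) :
    Disjoint (edgesIn (zdGraph d) Λ₁) (edgesIn (zdGraph d) Λ₂) := by
  rw [Finset.disjoint_left]
  intro e he₁ he₂
  rw [mem_edgesIn_iff] at he₁ he₂
  induction e using Sym2.ind with
  | _ a b =>
    exact Finset.disjoint_left.1 hdis (he₁.2 a (Sym2.mem_mk_left a b)) (he₂.2 a (Sym2.mem_mk_left a b))

/-- **`Z_{Λ₁ ∪ Λ₂, β, h} = Z_{Λ₁,β,h} · Z_{Λ₂,β,h}` for disjoint separated volumes** (the free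
boundary condition Gibbs weight of `Λ₁ ∪ Λ₂` is the product of those of the parts when no edge of
`ℤ^d` joins them). [folklore] -/
theorem partitionFunction_union_of_separated {Λ₁ Λ₂ : Finset (Site d)} (hdis : Disjoint Λ₁ Λ₂)
    (hsep : ∀ x ∈ Λ₁, ∀ y ∈ Λ₂, ¬ (zdGraph d).Adj x y) (β : ℝ) (h : ℂ) :
    partitionFunction d (Λ₁ ∪ Λ₂) β h = partitionFunction d Λ₁ β h * partitionFunction d Λ₂ β h := by
  classical
  set Λ := Λ₁ ∪ Λ₂ with hΛ
  have hsub₁ : Λ₁ ⊆ Λ := Finset.subset_union_left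
  have hsub₂ : Λ₂ ⊆ Λ := Finset.subset_union_right
  set p : Λ → Prop := fun a => (a : Site d) ∈ Λ₁ with hp
  have hnotp : ∀ a : Λ, ¬ p a ↔ (a : Site d) ∈ Λ₂ := by
    intro a
    have ha : (a : Site d) ∈ Λ₁ ∨ (a : Site d) ∈ Λ₂ := Finset.mem_union.1 a.2
    constructor
    · intro hna
      exact ha.resolve_left hna
    · intro h2 h1
      exact Finset.disjoint_left.1 hdis h1 h2
  -- the summand of `Z_{Λᵢ}` read on a configuration of the subtype
  set E₁ : {a : Λ // p a} ≃ Λ₁ :=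
    { toFun := fun v => ⟨v.1.1, v.2⟩
      invFun := fun x => ⟨⟨x.1, hsub₁ x.2⟩, x.2⟩
      left_inv := fun v => rfl
      right_inv := fun x => rfl } with hE₁
  set E₂ : {a : Λ // ¬ p a} ≃ Λ₂ :=
    { toFun := fun w => ⟨w.1.1, (hnotp w.1).1 w.2⟩
      invFun := fun y => ⟨⟨y.1, hsub₂ y.2⟩, (hnotp ⟨y.1, hsub₂ y.2⟩).2 y.2⟩
      left_inv := fun w => rfl
      right_inv := fun y => rfl } with hE₂
  set F : Finset (Site d) → SpinConfig (Site d) → ℂ := fun Λ' σ =>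
    Complex.exp (((β * ∑ e ∈ edgesIn (zdGraph d) Λ', bondSpin σ e : ℝ) : ℂ) +
      h * ((∑ x ∈ Λ', spinAt x σ : ℝ) : ℂ)) with hF
  -- `F Λ'` only depends on the spins inside `Λ'`
  have hFdep : ∀ (Λ' : Finset (Site d)) (σ σ' : SpinConfig (Site d)),
      (∀ x ∈ Λ', σ x = σ' x) → F Λ' σ = F Λ' σ' := by
    intro Λ' σ σ' hσ
    simp only [hF]
    have hs : ∀ x ∈ Λ', spinAt x σ = spinAt x σ' := fun x hx => by simp [spinAt, hσ x hx]
    have hb : ∀ e ∈ edgesIn (zdGraph d) Λ', bondSpin σ e = bondSpin σ' e := by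
      intro e he
      rw [mem_edgesIn_iff] at he
      induction e using Sym2.ind with
      | _ a b => simp [hs a (he.2 a (Sym2.mem_mk_left a b)), hs b (he.2 b (Sym2.mem_mk_right a b))]
    rw [Finset.sum_congr rfl hb, Finset.sum_congr rfl hs]
  -- pointwise factorisation of the summand of `Z_Λ`
  have hpoint : ∀ τ : Λ → ℤˣ, F Λ (glue Λ τ .free) =
      F Λ₁ (glue Λ₁ (fun x => τ ⟨x.1, hsub₁ x.2⟩) .free) *
        F Λ₂ (glue Λ₂ (fun y => τ ⟨y.1, hsub₂ y.2⟩) .free) := by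
    intro τ
    have h1 : F Λ₁ (glue Λ τ .free) = F Λ₁ (glue Λ₁ (fun x => τ ⟨x.1, hsub₁ x.2⟩) .free) := by
      refine hFdep Λ₁ _ _ fun x hx => ?_
      rw [glue_apply_of_mem _ _ _ (hsub₁ hx), glue_apply_of_mem _ _ _ hx]
    have h2 : F Λ₂ (glue Λ τ .free) = F Λ₂ (glue Λ₂ (fun y => τ ⟨y.1, hsub₂ y.2⟩) .free) := by
      refine hFdep Λ₂ _ _ fun y hy => ?_
      rw [glue_apply_of_mem _ _ _ (hsub₂ hy), glue_apply_of_mem _ _ _ hy]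
    rw [← h1, ← h2]
    simp only [hF]
    rw [← Complex.exp_add]
    congr 1
    have hE : edgesIn (zdGraph d) Λ = edgesIn (zdGraph d) Λ₁ ∪ edgesIn (zdGraph d) Λ₂ :=
      edgesIn_union_of_separated hsep
    have hS : ∀ f : Site d → ℝ, ∑ x ∈ Λ, f x = ∑ x ∈ Λ₁, f x + ∑ x ∈ Λ₂, f x := fun f =>
      Finset.sum_union hdis
    rw [hE, Finset.sum_union (disjoint_edgesIn_of_disjoint hdis), hS]
    push_cast
    ring
  -- reindex the sum over configurations of `Λ` by pairs of configurations
  set G := Equiv.piEquivPiSubtypeProd p (fun _ : Λ => ℤˣ) with hG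
  have hZ : partitionFunction d Λ β h = ∑ τ : Λ → ℤˣ, F Λ (glue Λ τ .free) := rfl
  have hZ₁ : partitionFunction d Λ₁ β h = ∑ τ₁ : Λ₁ → ℤˣ, F Λ₁ (glue Λ₁ τ₁ .free) := rfl
  have hZ₂ : partitionFunction d Λ₂ β h = ∑ τ₂ : Λ₂ → ℤˣ, F Λ₂ (glue Λ₂ τ₂ .free) := rfl
  set e : (Λ → ℤˣ) ≃ (Λ₁ → ℤˣ) × (Λ₂ → ℤˣ) :=
    G.trans (Equiv.prodCongr (E₁.arrowCongr (Equiv.refl ℤˣ)) (E₂.arrowCongr (Equiv.refl ℤˣ))) with he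
  have hR : (∑ τ₁ : Λ₁ → ℤˣ, F Λ₁ (glue Λ₁ τ₁ .free)) * ∑ τ₂ : Λ₂ → ℤˣ, F Λ₂ (glue Λ₂ τ₂ .free) =
      ∑ q : (Λ₁ → ℤˣ) × (Λ₂ → ℤˣ), F Λ₁ (glue Λ₁ q.1 .free) * F Λ₂ (glue Λ₂ q.2 .free) := by
    rw [Fintype.sum_prod_type, Finset.sum_mul_sum]
  rw [hZ, hZ₁, hZ₂, hR]
  exact Fintype.sum_equiv e _ _ fun τ => by rw [hpoint τ]; rfl

end Separated

/-! ### Translation invariance of `Z_{Λ,β,h}` -/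

section Transport

/-- **Transport of `Z_{Λ,β,h}` along an injection of `ℤ^d` that is a graph isomorphism on `Λ`**
(e.g. a translation): `Z_{φ(Λ),β,h} = Z_{Λ,β,h}` (the free-boundary weight only involves the edges
inside `Λ` and the sites of `Λ`; cf. `isingHamiltonian_free_map`). [folklore] -/
theorem partitionFunction_map (φ : Site d ↪ Site d) {Λ : Finset (Site d)}
    (hadj : ∀ x ∈ Λ, ∀ y ∈ Λ, ((zdGraph d).Adj (φ x) (φ y) ↔ (zdGraph d).Adj x y)) (β : ℝ) (h : ℂ) :
    partitionFunction d (Λ.map φ) β h = partitionFunction d Λ β h := by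
  classical
  obtain ⟨e, hex⟩ := exists_equiv_map φ Λ
  unfold partitionFunction
  refine (Fintype.sum_equiv (e.arrowCongr (Equiv.refl ℤˣ)) _ _ fun τ => ?_).symm
  have he : (e.arrowCongr (Equiv.refl ℤˣ)) τ = τ ∘ e.symm := rfl
  rw [he, glue_map_free φ Λ hex, edgesIn_map φ hadj, Finset.sum_map, Finset.sum_map]
  simp only [Function.Embedding.coeFn_mk, bondSpin_extendAlong_map, spinAt_extendAlong]

/-- **Translation invariance**: `Z_{Λ+v,β,h} = Z_{Λ,β,h}`. [folklore] -/
theorem partitionFunction_shift (v : Site d) (Λ : Finset (Site d)) (β : ℝ) (h : ℂ) :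
    partitionFunction d (Λ.map (Site.shift v).toEmbedding) β h = partitionFunction d Λ β h :=
  partitionFunction_map (Site.shift v).toEmbedding (fun x _ y _ => zdGraph_adj_shift_iff v x y) β h

/-- Translation invariance of the cumulants `u_k(M_{Λ,β,0})`. [folklore] -/
theorem magnetizationCumulant_shift (v : Site d) (Λ : Finset (Site d)) (β : ℝ) (k : ℕ) :
    magnetizationCumulant d (Λ.map (Site.shift v).toEmbedding) β k = magnetizationCumulant d Λ β k := by
  unfold magnetizationCumulant
  simp_rw [partitionFunction_shift]

/-- Translation invariance of the first zero `α₁(Λ, β)`. [folklore] -/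
theorem firstZero_shift (v : Site d) (Λ : Finset (Site d)) (β : ℝ) :
    firstZero d (Λ.map (Site.shift v).toEmbedding) β = firstZero d Λ β := by
  unfold firstZero
  simp_rw [partitionFunction_shift]

end Transport

/-! ### The cumulants of `M_Λ` as cumulants of the pair-interaction model (dictionary) -/

section Dictionary

/-- The denominator of the moment generating function with the couplings of `Λ₀ ⊆ Λ` read on `Λ`
is the numerator at `h = 0`. [folklore] -/
theorem ofReal_sum_weight_eq {ι : Type*} [Fintype ι] [DecidableEq ι] (c : ι → ι → ℝ) (lam : ι → ℝ) :
    ((∑ ρ : SpinConfig ι, PairIsing.weight c ρ : ℝ) : ℂ) =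
      ∑ ρ : SpinConfig ι, Complex.exp ((0 : ℂ) * (PairIsing.weightedMagnetization lam ρ : ℂ)) *
        (PairIsing.weight c ρ : ℂ) := by
  push_cast
  simp

/-- **`Z_{Λ,β,h}/Z_{Λ,β,0}` is the moment generating function `⟨e^{hM_Λ}⟩`** of the
pair-interaction model on the sites of `Λ` with the couplings of `Λ` (`λ ≡ 1`).
[cite: JiangNewman2023, §2 eqs. (2.1)-(2.3)] -/
theorem mgf_eq_partitionFunction_div (Λ : Finset (Site d)) (β : ℝ) (h : ℂ) :
    PairIsing.mgf (fun a b : Λ => β * ∑ e' ∈ edgesIn (zdGraph d) Λ,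
        (if (Quot.out e' : Site d × Site d).1 = (a : Site d) ∧
          (Quot.out e' : Site d × Site d).2 = (b : Site d) then (1 : ℝ) else 0)) (fun _ => (1 : ℝ)) h =
      partitionFunction d Λ β h / partitionFunction d Λ β 0 := by
  rw [PairIsing.mgf, sum_exp_mul_weight_eq_partitionFunction, ofReal_sum_weight_eq _ (fun _ => (1 : ℝ)),
    sum_exp_mul_weight_eq_partitionFunction]

/-- **Dictionary: `u_n(M_{Λ,β,0}) = κ_n(M_Λ; c_Λ)`** — the `h`-derivatives at `0` of `ln Z_{Λ,β,h}`
(JN (2.2)–(2.3)) are the cumulants (`cumulantOf` of the moments `⟨M_Λ^m⟩`) of the total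
magnetisation under the pair-interaction average with the couplings of `Λ`, for `n ≥ 1`.
[cite: JiangNewman2023, §2 eqs. (2.2)-(2.3)] -/
theorem magnetizationCumulant_eq_cumulantOf {β : ℝ} (hβ : 0 ≤ β) {Λ : Finset (Site d)}
    (hΛ : Λ.Nonempty) {n : ℕ} (hn : 1 ≤ n) :
    magnetizationCumulant d Λ β n =
      cumulantOf (fun m => PairIsing.avg (fun a b : Λ => β * ∑ e' ∈ edgesIn (zdGraph d) Λ,
        (if (Quot.out e' : Site d × Site d).1 = (a : Site d) ∧
          (Quot.out e' : Site d × Site d).2 = (b : Site d) then (1 : ℝ) else 0))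
        (fun σ => PairIsing.weightedMagnetization (fun _ => (1 : ℝ)) σ ^ m)) n := by
  obtain ⟨m, rfl⟩ : ∃ m, n = m + 1 := ⟨n - 1, by omega⟩
  set c : Λ → Λ → ℝ := fun a b => β * ∑ e' ∈ edgesIn (zdGraph d) Λ,
    (if (Quot.out e' : Site d × Site d).1 = (a : Site d) ∧
      (Quot.out e' : Site d × Site d).2 = (b : Site d) then (1 : ℝ) else 0) with hc
  obtain ⟨L, hL, hexp, hLre⟩ := exists_log_partitionFunction hβ hΛ
  set α := firstZero d Λ β with hα
  have hα0 : 0 < α := (firstZero_spec hβ hΛ).1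
  have h0mem : (0 : ℂ) ∈ Metric.ball (0 : ℂ) α := Metric.mem_ball_self hα0
  have hLan : AnalyticAt ℂ L 0 := hL.analyticAt (Metric.isOpen_ball.mem_nhds h0mem)
  -- the mgf and its local logarithm `z ↦ -L 0 + L z`
  set f : ℂ → ℂ := PairIsing.mgf c (fun _ => (1 : ℝ)) with hf
  have hfan : AnalyticAt ℂ f 0 := (PairIsing.differentiable_mgf c _).analyticAt 0
  have hL'an : AnalyticAt ℂ (fun z => -L 0 + L z) 0 := analyticAt_const.add hLan
  have hZ0 : partitionFunction d Λ β 0 ≠ 0 := partitionFunction_zero_ne_zero Λ β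
  have hfL : ∀ᶠ z in 𝓝 0, f z = Complex.exp (-L 0 + L z) := by
    filter_upwards [Metric.isOpen_ball.mem_nhds h0mem] with z hz
    rw [hf, mgf_eq_partitionFunction_div, Complex.exp_add, Complex.exp_neg, hexp z hz, hexp 0 h0mem,
      div_eq_inv_mul]
  have key := iteratedDeriv_succ_eq_cumulantOf hfan hL'an hfL (PairIsing.mgf_zero c _) m
  rw [iteratedDeriv_const_add (Nat.succ_pos m)] at key
  simp_rw [hf, PairIsing.iteratedDeriv_mgf_zero] at key
  rw [cumulantOf_ofReal _ (by simp [PairIsing.avg_const]) (Nat.succ_pos m)] at key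
  have h0 : |(0 : ℝ)| < firstZero d Λ β := by simpa using hα0
  have hcoef := iteratedDeriv_log_eq hL hLre (m + 1) h0
  rw [Complex.ofReal_zero] at hcoef
  rw [hcoef] at key
  rw [magnetizationCumulant]
  exact_mod_cast key

end Dictionary

/-! ### Decoupling: the couplings of `Λ₀ ⊆ Λ` on the sites of `Λ` -/

section Decoupling

/-- **Decoupling, product form**: with the couplings of the SUB-volume `Λ₀ ⊆ Λ` on the sites of
`Λ`, the numerator of the moment generating function `⟨e^{hM_Λ}⟩` factorises as `Z_{Λ₀,β,h}` times
the numerator of the mgf of the FREE spins of `Λ ∖ Λ₀` (zero coupling). [folklore] -/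
theorem sum_exp_mul_weight_eq_mul {Λ₀ Λ : Finset (Site d)} (hsub : Λ₀ ⊆ Λ) (β : ℝ) (h : ℂ) :
    ∑ ρ : SpinConfig Λ, Complex.exp (h * (PairIsing.weightedMagnetization (fun _ => (1 : ℝ)) ρ : ℂ)) *
      (PairIsing.weight (fun a b : Λ => β * ∑ e' ∈ edgesIn (zdGraph d) Λ₀,
        (if (Quot.out e' : Site d × Site d).1 = (a : Site d) ∧
          (Quot.out e' : Site d × Site d).2 = (b : Site d) then (1 : ℝ) else 0)) ρ : ℂ) =
      partitionFunction d Λ₀ β h *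
        ∑ ρ₂ : SpinConfig {a : Λ // (a : Site d) ∉ Λ₀},
          Complex.exp (h * (PairIsing.weightedMagnetization (fun _ => (1 : ℝ)) ρ₂ : ℂ)) *
            (PairIsing.weight (0 : {a : Λ // (a : Site d) ∉ Λ₀} → {a : Λ // (a : Site d) ∉ Λ₀} → ℝ) ρ₂ : ℂ) := by
  classical
  set p : Λ → Prop := fun a => (a : Site d) ∈ Λ₀ with hp
  -- values inside `Λ₀` coded by a configuration on `{a // p a}`
  set r : ({a : Λ // p a} → ℤˣ) → Site d → ℝ := fun ρ₁ x =>
    if hx : x ∈ Λ₀ then ((ρ₁ ⟨⟨x, hsub hx⟩, hx⟩ : ℤ) : ℝ) else 0 with hr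
  set T₁ : ({a : Λ // p a} → ℤˣ) → ℂ := fun ρ₁ =>
    Complex.exp (h * ((∑ v, ((ρ₁ v : ℤ) : ℝ) : ℝ) : ℂ)) *
      (Real.exp (β * ∑ e' ∈ edgesIn (zdGraph d) Λ₀,
        r ρ₁ (Quot.out e' : Site d × Site d).1 * r ρ₁ (Quot.out e' : Site d × Site d).2) : ℂ) with hT₁
  set T₂ : ({a : Λ // ¬ p a} → ℤˣ) → ℂ := fun ρ₂ =>
    Complex.exp (h * ((∑ w, ((ρ₂ w : ℤ) : ℝ) : ℝ) : ℂ)) with hT₂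
  -- pointwise factorisation of the summand
  have hpoint : ∀ ρ : SpinConfig Λ,
      Complex.exp (h * (PairIsing.weightedMagnetization (fun _ => (1 : ℝ)) ρ : ℂ)) *
        (PairIsing.weight (fun a b : Λ => β * ∑ e' ∈ edgesIn (zdGraph d) Λ₀,
          (if (Quot.out e' : Site d × Site d).1 = (a : Site d) ∧
            (Quot.out e' : Site d × Site d).2 = (b : Site d) then (1 : ℝ) else 0)) ρ : ℂ) =
        T₁ (fun v => ρ v) * T₂ (fun w => ρ w) := by
    intro ρ
    rw [PairIsing.weight, sum_sum_coupling_eq hsub le_rfl β ρ, PairIsing.weightedMagnetization]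
    simp only [one_mul, hT₁, hT₂]
    -- the magnetisation splits
    have hM : ∑ u : Λ, spinAt u ρ = (∑ v : {a : Λ // p a}, ((ρ v : ℤ) : ℝ)) +
        ∑ w : {a : Λ // ¬ p a}, ((ρ w : ℤ) : ℝ) := by
      rw [← Fintype.sum_subtype_add_sum_subtype p fun u : Λ => spinAt u ρ]
      rfl
    -- the bonds inside `Λ₀` only see the `p`-part
    have hB : ∑ e' ∈ edgesIn (zdGraph d) Λ₀, bondSpin (glue Λ ρ .free) e' =
        ∑ e' ∈ edgesIn (zdGraph d) Λ₀,
          r (fun v => ρ v) (Quot.out e' : Site d × Site d).1 *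
            r (fun v => ρ v) (Quot.out e' : Site d × Site d).2 := by
      refine Finset.sum_congr rfl fun e' he' => ?_
      obtain ⟨ha, hb, hbond⟩ := out_spec he'
      rw [hbond]
      simp only [hr, ha, hb, dif_pos]
      rw [spinAt_glue_of_mem _ _ (hsub ha), spinAt_glue_of_mem _ _ (hsub hb)]
      rfl
    rw [hM, hB]
    push_cast
    rw [mul_add, Complex.exp_add]
    ring
  -- sum over the product decomposition
  set E₁ := Equiv.piEquivPiSubtypeProd p (fun _ : Λ => ℤˣ) with hE₁
  have hsum : ∑ ρ : SpinConfig Λ, T₁ (fun v => ρ v) * T₂ (fun w => ρ w) =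
      (∑ ρ₁, T₁ ρ₁) * ∑ ρ₂, T₂ ρ₂ := by
    rw [Fintype.sum_equiv E₁ (fun ρ => T₁ (fun v => ρ v) * T₂ (fun w => ρ w))
      (fun q => T₁ q.1 * T₂ q.2) (fun ρ => rfl), Fintype.sum_prod_type, Finset.sum_mul_sum]
  -- the first factor is `Z_{Λ₀,β,h}`
  set E₂ : {a : Λ // p a} ≃ Λ₀ :=
    { toFun := fun v => ⟨v.1.1, v.2⟩
      invFun := fun x => ⟨⟨x.1, hsub x.2⟩, x.2⟩
      left_inv := fun v => rfl
      right_inv := fun x => rfl } with hE₂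
  have hfirst : ∑ ρ₁, T₁ ρ₁ = partitionFunction d Λ₀ β h := by
    unfold partitionFunction
    refine Fintype.sum_equiv (Equiv.arrowCongr E₂ (Equiv.refl ℤˣ)) _ _ fun ρ₁ => ?_
    set τ : Λ₀ → ℤˣ := Equiv.arrowCongr E₂ (Equiv.refl ℤˣ) ρ₁ with hτ
    have hτv : ∀ x (hx : x ∈ Λ₀), τ ⟨x, hx⟩ = ρ₁ ⟨⟨x, hsub hx⟩, hx⟩ := fun x hx => rfl
    have hrx : ∀ x (hx : x ∈ Λ₀), r ρ₁ x = spinAt x (glue Λ₀ τ .free) := by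
      intro x hx
      rw [spinAt_glue_of_mem _ _ hx, spinAt, hτv x hx]
      simp [hr, hx]
    have hS : ∑ e' ∈ edgesIn (zdGraph d) Λ₀,
        r ρ₁ (Quot.out e' : Site d × Site d).1 * r ρ₁ (Quot.out e' : Site d × Site d).2 =
        ∑ e' ∈ edgesIn (zdGraph d) Λ₀, bondSpin (glue Λ₀ τ .free) e' := by
      refine Finset.sum_congr rfl fun e' he' => ?_
      obtain ⟨ha, hb, hbond⟩ := out_spec he'
      rw [hbond, hrx _ ha, hrx _ hb]
    have hMτ : ∑ x ∈ Λ₀, spinAt x (glue Λ₀ τ .free) = ∑ v : {a : Λ // p a}, ((ρ₁ v : ℤ) : ℝ) := by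
      rw [sum_spinAt_glue, ← Equiv.sum_comp E₂]
      rfl
    simp only [hT₁]
    rw [hS, hMτ, Complex.ofReal_exp, ← Complex.exp_add]
    congr 1
    push_cast
    ring
  rw [Finset.sum_congr rfl fun ρ _ => hpoint ρ, hsum, hfirst]
  congr 1
  refine Finset.sum_congr rfl fun ρ₂ _ => ?_
  simp only [hT₂, PairIsing.weight_zero_coupling, PairIsing.weightedMagnetization, spinAt, one_mul,
    Complex.ofReal_one, mul_one]
  rfl


/-- The moment generating function has an analytic logarithm at `0`, which is a local logarithm.
[folklore] -/
theorem analyticAt_log_mgf {ι : Type*} [Fintype ι] [DecidableEq ι] (c : ι → ι → ℝ) (lam : ι → ℝ) :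
    AnalyticAt ℂ (fun z => Complex.log (PairIsing.mgf c lam z)) 0 ∧
      ∀ᶠ z in 𝓝 0, PairIsing.mgf c lam z = Complex.exp (Complex.log (PairIsing.mgf c lam z)) := by
  refine ⟨((PairIsing.differentiable_mgf c lam).analyticAt 0).clog
    (by rw [PairIsing.mgf_zero]; exact Complex.one_mem_slitPlane), ?_⟩
  have hne : ∀ᶠ z in 𝓝 (0 : ℂ), PairIsing.mgf c lam z ≠ 0 :=
    (PairIsing.continuous_mgf c lam).continuousAt.eventually_ne
      (by rw [PairIsing.mgf_zero]; exact one_ne_zero)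
  filter_upwards [hne] with z hz
  rw [Complex.exp_log hz]

/-- **Cumulants add over independent systems**: if the moment generating function of `(ι, c, λ)`
is the product of those of `(ι₁, c₁, λ₁)` and `(ι₂, c₂, λ₂)`, then
`κ_n(X; c) = κ_n(X₁; c₁) + κ_n(X₂; c₂)` for `n ≥ 1` (the logarithms add). [folklore] -/
theorem cumulantOf_eq_add_of_mgf_eq_mul {ι ι₁ ι₂ : Type*} [Fintype ι] [DecidableEq ι] [Fintype ι₁]
    [DecidableEq ι₁] [Fintype ι₂] [DecidableEq ι₂] {c : ι → ι → ℝ} {lam : ι → ℝ}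
    {c₁ : ι₁ → ι₁ → ℝ} {lam₁ : ι₁ → ℝ} {c₂ : ι₂ → ι₂ → ℝ} {lam₂ : ι₂ → ℝ}
    (hmul : ∀ h : ℂ, PairIsing.mgf c lam h = PairIsing.mgf c₁ lam₁ h * PairIsing.mgf c₂ lam₂ h)
    {n : ℕ} (hn : 1 ≤ n) :
    cumulantOf (fun m => PairIsing.avg c (fun σ => PairIsing.weightedMagnetization lam σ ^ m)) n =
      cumulantOf (fun m => PairIsing.avg c₁ (fun σ => PairIsing.weightedMagnetization lam₁ σ ^ m)) n +
        cumulantOf (fun m => PairIsing.avg c₂ (fun σ => PairIsing.weightedMagnetization lam₂ σ ^ m)) n := by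
  obtain ⟨m, rfl⟩ : ∃ m, n = m + 1 := ⟨n - 1, by omega⟩
  obtain ⟨h₁an, h₁exp⟩ := analyticAt_log_mgf c₁ lam₁
  obtain ⟨h₂an, h₂exp⟩ := analyticAt_log_mgf c₂ lam₂
  set L : ℂ → ℂ := fun z => Complex.log (PairIsing.mgf c₁ lam₁ z) + Complex.log (PairIsing.mgf c₂ lam₂ z)
    with hL
  have hLan : AnalyticAt ℂ L 0 := h₁an.add h₂an
  have hfL : ∀ᶠ z in 𝓝 0, PairIsing.mgf c lam z = Complex.exp (L z) := by
    filter_upwards [h₁exp, h₂exp] with z hz₁ hz₂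
    rw [hmul, hL]
    dsimp only
    rw [Complex.exp_add, ← hz₁, ← hz₂]
  have key := iteratedDeriv_succ_eq_cumulantOf ((PairIsing.differentiable_mgf c lam).analyticAt 0)
    hLan hfL (PairIsing.mgf_zero c lam) m
  simp_rw [PairIsing.iteratedDeriv_mgf_zero] at key
  rw [cumulantOf_ofReal _ (by simp [PairIsing.avg_const]) (Nat.succ_pos m)] at key
  have hadd : iteratedDeriv (m + 1) L 0 =
      iteratedDeriv (m + 1) (fun z => Complex.log (PairIsing.mgf c₁ lam₁ z)) 0 +
        iteratedDeriv (m + 1) (fun z => Complex.log (PairIsing.mgf c₂ lam₂ z)) 0 := by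
    rw [hL]
    exact iteratedDeriv_fun_add h₁an.contDiffAt h₂an.contDiffAt
  rw [hadd, PairIsing.iteratedDeriv_log_mgf, PairIsing.iteratedDeriv_log_mgf] at key
  exact_mod_cast key.symm

/-- **The mgf with the couplings of `Λ₀ ⊆ Λ` on the sites of `Λ` factorises**:
`⟨e^{hM_Λ}⟩_{c_{Λ₀} on Λ} = ⟨e^{hM_{Λ₀}}⟩_{Λ₀} · ⟨e^{h ∑_{u ∈ Λ∖Λ₀} σ_u}⟩_0`. [folklore] -/
theorem mgf_couplingOfSubset_eq_mul {Λ₀ Λ : Finset (Site d)} (hsub : Λ₀ ⊆ Λ) (β : ℝ) (h : ℂ) :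
    PairIsing.mgf (fun a b : Λ => β * ∑ e' ∈ edgesIn (zdGraph d) Λ₀,
        (if (Quot.out e' : Site d × Site d).1 = (a : Site d) ∧
          (Quot.out e' : Site d × Site d).2 = (b : Site d) then (1 : ℝ) else 0)) (fun _ => (1 : ℝ)) h =
      PairIsing.mgf (fun a b : Λ₀ => β * ∑ e' ∈ edgesIn (zdGraph d) Λ₀,
        (if (Quot.out e' : Site d × Site d).1 = (a : Site d) ∧
          (Quot.out e' : Site d × Site d).2 = (b : Site d) then (1 : ℝ) else 0)) (fun _ => (1 : ℝ)) h *
        PairIsing.mgf (0 : {a : Λ // (a : Site d) ∉ Λ₀} → {a : Λ // (a : Site d) ∉ Λ₀} → ℝ)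
          (fun _ => (1 : ℝ)) h := by
  unfold PairIsing.mgf
  rw [ofReal_sum_weight_eq _ (fun _ => (1 : ℝ)), ofReal_sum_weight_eq _ (fun _ => (1 : ℝ)),
    ofReal_sum_weight_eq (0 : {a : Λ // (a : Site d) ∉ Λ₀} → {a : Λ // (a : Site d) ∉ Λ₀} → ℝ)
      (fun _ => (1 : ℝ)),
    sum_exp_mul_weight_eq_mul hsub β h, sum_exp_mul_weight_eq_mul hsub β 0,
    sum_exp_mul_weight_eq_partitionFunction, sum_exp_mul_weight_eq_partitionFunction, mul_div_mul_comm]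

/-- **The cumulants with the couplings of `Λ₀ ⊆ Λ` on the sites of `Λ`**: for `n ≥ 1`,
`κ_n(M_Λ; c_{Λ₀} on Λ) = u_n(M_{Λ₀,β,0}) + κ_n(∑_{u ∈ Λ∖Λ₀} σ_u; 0)` (independent free spins
outside `Λ₀`). [folklore] -/
theorem cumulantOf_couplingOfSubset {β : ℝ} (hβ : 0 ≤ β) {Λ₀ Λ : Finset (Site d)} (hsub : Λ₀ ⊆ Λ)
    (hΛ₀ : Λ₀.Nonempty) {n : ℕ} (hn : 1 ≤ n) :
    cumulantOf (fun m => PairIsing.avg (fun a b : Λ => β * ∑ e' ∈ edgesIn (zdGraph d) Λ₀,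
        (if (Quot.out e' : Site d × Site d).1 = (a : Site d) ∧
          (Quot.out e' : Site d × Site d).2 = (b : Site d) then (1 : ℝ) else 0))
        (fun σ => PairIsing.weightedMagnetization (fun _ => (1 : ℝ)) σ ^ m)) n =
      magnetizationCumulant d Λ₀ β n +
        cumulantOf (fun m => PairIsing.avg
          (0 : {a : Λ // (a : Site d) ∉ Λ₀} → {a : Λ // (a : Site d) ∉ Λ₀} → ℝ)
          (fun σ => PairIsing.weightedMagnetization (fun _ => (1 : ℝ)) σ ^ m)) n := by
  rw [cumulantOf_eq_add_of_mgf_eq_mul (fun h => mgf_couplingOfSubset_eq_mul hsub β h) hn,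
    magnetizationCumulant_eq_cumulantOf hβ hΛ₀ hn]

/-- The couplings of `Λ₀` read on `Λ` are nonnegative and dominated by the couplings of `Λ`
(for `Λ₀ ⊆ Λ`, `β ≥ 0`). [folklore] -/
theorem couplingOfSubset_nonneg_le {β : ℝ} (hβ : 0 ≤ β) {Λ₀ Λ : Finset (Site d)} (hsub : Λ₀ ⊆ Λ) :
    (∀ a b : Λ, (0 : ℝ) ≤ β * ∑ e' ∈ edgesIn (zdGraph d) Λ₀,
        (if (Quot.out e' : Site d × Site d).1 = (a : Site d) ∧
          (Quot.out e' : Site d × Site d).2 = (b : Site d) then (1 : ℝ) else 0)) ∧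
    (∀ a b : Λ, β * ∑ e' ∈ edgesIn (zdGraph d) Λ₀,
        (if (Quot.out e' : Site d × Site d).1 = (a : Site d) ∧
          (Quot.out e' : Site d × Site d).2 = (b : Site d) then (1 : ℝ) else 0) ≤
      β * ∑ e' ∈ edgesIn (zdGraph d) Λ,
        (if (Quot.out e' : Site d × Site d).1 = (a : Site d) ∧
          (Quot.out e' : Site d × Site d).2 = (b : Site d) then (1 : ℝ) else 0)) := by
  have hterm : ∀ (e' : Sym2 (Site d)) (a b : Λ), (0 : ℝ) ≤
      (if (Quot.out e' : Site d × Site d).1 = (a : Site d) ∧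
        (Quot.out e' : Site d × Site d).2 = (b : Site d) then (1 : ℝ) else 0) :=
    fun e' a b => by split_ifs <;> norm_num
  exact ⟨fun a b => mul_nonneg hβ (Finset.sum_nonneg fun e' _ => hterm e' a b),
    fun a b => mul_le_mul_of_nonneg_left (Finset.sum_le_sum_of_subset_of_nonneg
      (edgesIn_mono (zdGraph d) hsub) fun e' _ _ => hterm e' a b) hβ⟩

/-- **Shlosman's sign for the cumulants of the magnetisation, given CJN Theorem 1**:
`(-1)^{k-1} u_{2k}(M_{Λ,β,0}) ≥ 0` for `β ≥ 0`, `k ≥ 1`. [cite: CamiaJiangNewman2023, Thm 1 and Remark 1] -/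
theorem magnetizationCumulant_sign_of_thm1 (h1 : CamiaJiangNewman2023_thm1) {β : ℝ} (hβ : 0 ≤ β)
    {Λ : Finset (Site d)} (hΛ : Λ.Nonempty) {k : ℕ} (hk : 1 ≤ k) :
    0 ≤ (-1 : ℝ) ^ (k - 1) * magnetizationCumulant d Λ β (2 * k) := by
  obtain ⟨hc0, -⟩ := couplingOfSubset_nonneg_le (d := d) hβ (subset_refl Λ)
  rw [magnetizationCumulant_eq_cumulantOf hβ hΛ (by omega)]
  have h00 := PairIsing.cumulant_weightedMagnetization_zero_coupling_nonneg (ι := Λ)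
    (fun _ => (1 : ℝ)) hk
  have h0c := cumulant_weightedMagnetization_mono_of_thm1 h1 (c := 0) (fun _ _ => le_rfl) hc0
    (fun _ => zero_le_one) hk
  exact h00.trans h0c

/-- **Volume monotonicity of the even cumulants, given CJN Theorem 1** (JN's use of CJN Thm 1 in
the proof of Prop. 1, eqs. (2.7)–(2.9), in finite volume): for `β ≥ 0`, nonempty `Λ₀ ⊆ Λ` and
`k ≥ 1`, `(-1)^{k-1} u_{2k}(M_{Λ₀,β,0}) ≤ (-1)^{k-1} u_{2k}(M_{Λ,β,0})` — the model on `Λ₀` plus the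
free spins of `Λ ∖ Λ₀` is the model on `Λ` with the couplings outside `Λ₀` switched off, its
`2k`-th cumulant is `u_{2k}(M_{Λ₀})` plus a term of Shlosman's sign, and raising the couplings
raises `(-1)^{k-1} κ_{2k}`. [cite: JiangNewman2023, Prop. 1 (proof), with CamiaJiangNewman2023 Thm 1] -/
theorem magnetizationCumulant_mono_of_thm1 (h1 : CamiaJiangNewman2023_thm1) {β : ℝ} (hβ : 0 ≤ β)
    {Λ₀ Λ : Finset (Site d)} (hsub : Λ₀ ⊆ Λ) (hΛ₀ : Λ₀.Nonempty) {k : ℕ} (hk : 1 ≤ k) :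
    (-1 : ℝ) ^ (k - 1) * magnetizationCumulant d Λ₀ β (2 * k) ≤
      (-1 : ℝ) ^ (k - 1) * magnetizationCumulant d Λ β (2 * k) := by
  have hΛ : Λ.Nonempty := hΛ₀.mono hsub
  obtain ⟨hc0, hcc'⟩ := couplingOfSubset_nonneg_le (d := d) hβ hsub
  have hmono := cumulant_weightedMagnetization_mono_of_thm1 h1 hc0 hcc' (fun _ => zero_le_one) hk
  rw [cumulantOf_couplingOfSubset hβ hsub hΛ₀ (by omega),
    ← magnetizationCumulant_eq_cumulantOf hβ hΛ (by omega)] at hmono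
  have h2 := PairIsing.cumulant_weightedMagnetization_zero_coupling_nonneg
    (ι := {a : Λ // (a : Site d) ∉ Λ₀}) (fun _ => (1 : ℝ)) hk
  linarith [mul_add ((-1 : ℝ) ^ (k - 1)) (magnetizationCumulant d Λ₀ β (2 * k))
    (cumulantOf (fun m => PairIsing.avg
      (0 : {a : Λ // (a : Site d) ∉ Λ₀} → {a : Λ // (a : Site d) ∉ Λ₀} → ℝ)
      (fun σ => PairIsing.weightedMagnetization (fun _ => (1 : ℝ)) σ ^ m)) (2 * k))]

/-- **`|u_{2k}(M_{Λ₀,β,0})| ≤ |u_{2k}(M_{Λ,β,0})|` for `Λ₀ ⊆ Λ`, given CJN Theorem 1.**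
[cite: JiangNewman2023, Prop. 1 (proof), with CamiaJiangNewman2023 Thm 1] -/
theorem abs_magnetizationCumulant_mono_of_thm1 (h1 : CamiaJiangNewman2023_thm1) {β : ℝ} (hβ : 0 ≤ β)
    {Λ₀ Λ : Finset (Site d)} (hsub : Λ₀ ⊆ Λ) (hΛ₀ : Λ₀.Nonempty) {k : ℕ} (hk : 1 ≤ k) :
    |magnetizationCumulant d Λ₀ β (2 * k)| ≤ |magnetizationCumulant d Λ β (2 * k)| := by
  have hs₀ := magnetizationCumulant_sign_of_thm1 h1 hβ hΛ₀ hk (d := d)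
  have hs := magnetizationCumulant_sign_of_thm1 h1 hβ (hΛ₀.mono hsub) hk (d := d)
  have hmono := magnetizationCumulant_mono_of_thm1 h1 hβ hsub hΛ₀ hk (d := d)
  have habs : ∀ x : ℝ, |x| = |(-1 : ℝ) ^ (k - 1) * x| := fun x => by
    rw [abs_mul, abs_pow, abs_neg, abs_one, one_pow, one_mul]
  rw [habs, habs (magnetizationCumulant d Λ β (2 * k)), abs_of_nonneg hs₀, abs_of_nonneg hs]
  exact hmono


end Decoupling

/-! ### Separated tilings: `(2r+1)^d` translates of `B_n` at mutual distance `≥ 2` inside `B_{(2n+2)r+n}` -/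

section Tiling

/-- Two distinct translates `B_n + (2n+2)t`, `B_n + (2n+2)t'` are at sup-distance `≥ 2`: some
coordinate of their points differs by at least `2`. [folklore] -/
theorem two_le_sub_of_mem_tile {n : ℕ} {t t' : Site d} (htt' : t ≠ t') {x x' : Site d}
    (hx : x ∈ (box d n).map (Site.shift ((((2 * n + 2 : ℕ) : ℤ)) • t)).toEmbedding)
    (hx' : x' ∈ (box d n).map (Site.shift ((((2 * n + 2 : ℕ) : ℤ)) • t')).toEmbedding) :
    ∃ i, 2 ≤ x i - x' i ∨ 2 ≤ x' i - x i := by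
  rw [Finset.mem_map_equiv] at hx hx'
  rw [Site.shift_symm_apply, mem_box] at hx hx'
  obtain ⟨i, hi⟩ := Function.ne_iff.1 htt'
  refine ⟨i, ?_⟩
  obtain ⟨h1, h2⟩ := hx i
  obtain ⟨h1', h2'⟩ := hx' i
  simp only [Pi.sub_apply, Pi.smul_apply, smul_eq_mul] at h1 h2 h1' h2'
  set s : ℤ := ((2 * n + 2 : ℕ) : ℤ) with hs
  have hs' : s = 2 * n + 2 := by rw [hs]; push_cast; ring
  set P : ℤ := s * t i with hP
  set P' : ℤ := s * t' i with hP'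
  have hPP' : s ≤ P - P' ∨ P - P' ≤ -s := by
    rcases lt_or_gt_of_ne hi with hlt | hgt
    · right
      have : P - P' = s * (t i - t' i) := by rw [hP, hP', mul_sub]
      rw [this]
      nlinarith
    · left
      have : P - P' = s * (t i - t' i) := by rw [hP, hP', mul_sub]
      rw [this]
      nlinarith
  omega

/-- Distinct translates `B_n + (2n+2)t`, `B_n + (2n+2)t'` are disjoint. [folklore] -/
theorem disjoint_tile {n : ℕ} {t t' : Site d} (htt' : t ≠ t') :
    Disjoint ((box d n).map (Site.shift ((((2 * n + 2 : ℕ) : ℤ)) • t)).toEmbedding)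
      ((box d n).map (Site.shift ((((2 * n + 2 : ℕ) : ℤ)) • t')).toEmbedding) := by
  rw [Finset.disjoint_left]
  intro x hx hx'
  obtain ⟨i, hi⟩ := two_le_sub_of_mem_tile htt' hx hx'
  omega

/-- Distinct translates `B_n + (2n+2)t`, `B_n + (2n+2)t'` are separated: no edge of `ℤ^d` joins them.
[folklore] -/
theorem not_adj_of_mem_tile {n : ℕ} {t t' : Site d} (htt' : t ≠ t') {x x' : Site d}
    (hx : x ∈ (box d n).map (Site.shift ((((2 * n + 2 : ℕ) : ℤ)) • t)).toEmbedding)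
    (hx' : x' ∈ (box d n).map (Site.shift ((((2 * n + 2 : ℕ) : ℤ)) • t')).toEmbedding) :
    ¬ (zdGraph d).Adj x x' := by
  obtain ⟨i, hi⟩ := two_le_sub_of_mem_tile htt' hx hx'
  rw [zdGraph_adj_iff]
  rintro ⟨j, hj | hj⟩
  · have := congrFun hj i
    simp only [Pi.add_apply, Pi.single_apply] at this
    split_ifs at this <;> omega
  · have := congrFun hj i
    simp only [Pi.add_apply, Pi.single_apply] at this
    split_ifs at this <;> omega

/-- The translate `B_n + (2n+2)t` with `t ∈ B_r` lies in `B_{(2n+2)r+n}`. [folklore] -/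
theorem tile_subset_box {n r : ℕ} {t : Site d} (ht : t ∈ box d r) :
    (box d n).map (Site.shift ((((2 * n + 2 : ℕ) : ℤ)) • t)).toEmbedding ⊆ box d ((2 * n + 2) * r + n) := by
  intro x hx
  rw [Finset.mem_map_equiv, Site.shift_symm_apply, mem_box] at hx
  rw [mem_box] at ht ⊢
  intro i
  obtain ⟨h1, h2⟩ := hx i
  obtain ⟨h3, h4⟩ := ht i
  simp only [Pi.sub_apply, Pi.smul_apply, smul_eq_mul] at h1 h2
  set s : ℤ := ((2 * n + 2 : ℕ) : ℤ) with hs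
  have hs0 : 0 ≤ s := by rw [hs]; positivity
  have hlo : -(s * r) ≤ s * t i := by nlinarith
  have hhi : s * t i ≤ s * r := by nlinarith
  have hcast : (((2 * n + 2) * r + n : ℕ) : ℤ) = s * r + n := by rw [hs]; push_cast; ring
  rw [hcast]
  constructor <;> omega

/-- The union of the translates `B_n + (2n+2)t`, `t ∈ S ⊆ B_r`, lies in `B_{(2n+2)r+n}`. [folklore] -/
theorem biUnion_tile_subset_box {n r : ℕ} {S : Finset (Site d)} (hS : S ⊆ box d r) :
    S.biUnion (fun t => (box d n).map (Site.shift ((((2 * n + 2 : ℕ) : ℤ)) • t)).toEmbedding) ⊆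
      box d ((2 * n + 2) * r + n) :=
  Finset.biUnion_subset.2 fun _ ht => tile_subset_box (hS ht)

/-- `Z_{∅,β,h} = 1`. [folklore] -/
theorem partitionFunction_empty (β : ℝ) (h : ℂ) : partitionFunction d ∅ β h = 1 := by
  have hE : edgesIn (zdGraph d) (∅ : Finset (Site d)) = ∅ := by
    ext e
    simp only [mem_edgesIn_iff, Finset.notMem_empty, iff_false, not_and]
    intro _ hmem
    induction e using Sym2.ind with
    | _ a b => exact hmem a (Sym2.mem_mk_left a b)
  unfold partitionFunction
  simp [hE]

/-- **`Z` of a separated union of translates of `B_n` is a power of `Z_{B_n}`**: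
`Z_{⋃_{t ∈ S} (B_n + (2n+2)t), β, h} = Z_{B_n,β,h}^{|S|}`. [folklore] -/
theorem partitionFunction_biUnion_tile (n : ℕ) (S : Finset (Site d)) (β : ℝ) (h : ℂ) :
    partitionFunction d (S.biUnion (fun t => (box d n).map
        (Site.shift ((((2 * n + 2 : ℕ) : ℤ)) • t)).toEmbedding)) β h =
      partitionFunction d (box d n) β h ^ S.card := by
  classical
  induction S using Finset.induction_on with
  | empty => rw [Finset.biUnion_empty, partitionFunction_empty, Finset.card_empty, pow_zero]
  | insert t S ht ih =>
    rw [Finset.biUnion_insert, Finset.card_insert_of_notMem ht, pow_succ',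
      partitionFunction_union_of_separated, ih, partitionFunction_shift]
    · rw [Finset.disjoint_biUnion_right]
      intro t' ht'
      exact disjoint_tile (by rintro rfl; exact ht ht')
    · intro x hx y hy
      obtain ⟨t', ht', hy'⟩ := Finset.mem_biUnion.1 hy
      exact not_adj_of_mem_tile (by rintro rfl; exact ht ht') hx hy'

/-- **The cumulants of the magnetisation of a separated union of `|S|` translates of `B_n` are
`|S|` times those of `B_n`** (`ln Z` is additive over separated components and translation
invariant). [folklore] -/
theorem magnetizationCumulant_biUnion_tile (n : ℕ) (S : Finset (Site d)) (β : ℝ) (k : ℕ) :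
    magnetizationCumulant d (S.biUnion (fun t => (box d n).map
        (Site.shift ((((2 * n + 2 : ℕ) : ℤ)) • t)).toEmbedding)) β k =
      S.card * magnetizationCumulant d (box d n) β k := by
  unfold magnetizationCumulant
  have hfun : (fun h : ℝ => Real.log (partitionFunction d (S.biUnion (fun t => (box d n).map
        (Site.shift ((((2 * n + 2 : ℕ) : ℤ)) • t)).toEmbedding)) β h).re) =
      fun h : ℝ => (S.card : ℝ) * Real.log (partitionFunction d (box d n) β h).re := by
    funext h
    rw [partitionFunction_biUnion_tile, partitionFunction_ofReal_eq_re (box d n) β h,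
      ← Complex.ofReal_pow, Complex.ofReal_re, Complex.ofReal_re, Real.log_pow]
  rw [hfun, iteratedDeriv_const_mul_field]

/-- **`(2r+1)^d |u_{2k}(M_{B_n})| ≤ |u_{2k}(M_{B_{(2n+2)r+n}})|`, given CJN Theorem 1**: the box
`B_{(2n+2)r+n}` contains `(2r+1)^d` separated translates of `B_n`. [cite: JiangNewman2023, Prop. 1 (proof, eq. (2.9)), with CamiaJiangNewman2023 Thm 1] -/
theorem card_mul_abs_magnetizationCumulant_le_of_thm1 (h1 : CamiaJiangNewman2023_thm1) {β : ℝ}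
    (hβ : 0 ≤ β) (n r : ℕ) {k : ℕ} (hk : 1 ≤ k) :
    ((2 * r + 1) ^ d : ℕ) * |magnetizationCumulant d (box d n) β (2 * k)| ≤
      |magnetizationCumulant d (box d ((2 * n + 2) * r + n)) β (2 * k)| := by
  classical
  set Λ : Finset (Site d) := (box d r).biUnion (fun t => (box d n).map
    (Site.shift ((((2 * n + 2 : ℕ) : ℤ)) • t)).toEmbedding) with hΛ
  have hΛne : Λ.Nonempty := by
    refine ⟨0, Finset.mem_biUnion.2 ⟨0, zero_mem_box d r, ?_⟩⟩
    rw [Finset.mem_map_equiv, Site.shift_symm_apply]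
    simp
  have hsub : Λ ⊆ box d ((2 * n + 2) * r + n) := biUnion_tile_subset_box (subset_refl _)
  have hmono := abs_magnetizationCumulant_mono_of_thm1 h1 hβ hsub hΛne hk (d := d)
  rw [hΛ, magnetizationCumulant_biUnion_tile, card_box, abs_mul, Nat.abs_cast] at hmono
  exact hmono

end Tiling

/-! ### JN (2.23): `1/α₁(ℤ^d,β) ≤ limsup_k [|f_β^{(2k)}(0)|/(2k)!]^{1/(2k)}` below `β_c`, given CJN Theorem 1 -/

section Subcritical

/-- **`(2n+2)^{-d} |u_{2k}(M_{B_n,β,0})| ≤ |f_β^{(2k)}(0)|`, given CJN Theorem 1 and a positive limit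
`a` of the first zeros** (JN (2.9) with (2.21): `|u_{2k}(M_{B_n})|/|B_n| ≲ |b_{2k}| = |f_β^{(2k)}(0)|`;
here through the boxes `B_{(2n+2)r+n} ⊇ (2r+1)^d` separated translates of `B_n`, `r → ∞`, and the
convergence of the cumulant densities `tendsto_magnetizationCumulant_div_card`).
[cite: JiangNewman2023, Prop. 1 and eq. (2.21)] -/
theorem abs_magnetizationCumulant_le_of_thm1 (h1 : CamiaJiangNewman2023_thm1) {β : ℝ} (hβ : 0 ≤ β)
    {a : ℝ} (hlim : Tendsto (fun n : ℕ => firstZero d (box d n) β) atTop (𝓝 a)) (ha : 0 < a)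
    (n : ℕ) {k : ℕ} (hk : 1 ≤ k) :
    ((2 * n + 2 : ℝ) ^ d)⁻¹ * |magnetizationCumulant d (box d n) β (2 * k)| ≤
      |iteratedDeriv (2 * k) (freeEnergy d β) 0| := by
  -- the boxes `B_{(2n+2)r+n}`, `r → ∞`
  have hm : Tendsto (fun r : ℕ => (2 * n + 2) * r + n) atTop atTop := by
    refine tendsto_atTop_mono (fun r => ?_) tendsto_id
    show r ≤ (2 * n + 2) * r + n
    nlinarith
  have hT := ((tendsto_magnetizationCumulant_div_card hβ hlim ha (2 * k)).comp hm).abs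
  refine ge_of_tendsto' hT fun r => ?_
  have hle := card_mul_abs_magnetizationCumulant_le_of_thm1 h1 hβ n r hk (d := d)
  push_cast at hle
  have hpos : (0 : ℝ) < #(box d ((2 * n + 2) * r + n)) :=
    Nat.cast_pos.2 (Finset.card_pos.2 (box_nonempty d _))
  have hnat : (2 * ((2 * n + 2) * r + n) + 1) ^ d ≤ ((2 * n + 2) * (2 * r + 1)) ^ d :=
    Nat.pow_le_pow_left (by nlinarith) d
  have hcardle : (#(box d ((2 * n + 2) * r + n)) : ℝ) ≤ (2 * n + 2 : ℝ) ^ d * (2 * r + 1 : ℝ) ^ d := by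
    rw [card_box, ← mul_pow]
    exact_mod_cast hnat
  have hn0 : (0 : ℝ) < (2 * n + 2 : ℝ) ^ d := by positivity
  rw [Function.comp_apply, abs_div, Nat.abs_cast, le_div_iff₀ hpos]
  calc ((2 * n + 2 : ℝ) ^ d)⁻¹ * |magnetizationCumulant d (box d n) β (2 * k)| *
        (#(box d ((2 * n + 2) * r + n)) : ℝ)
      ≤ ((2 * n + 2 : ℝ) ^ d)⁻¹ * |magnetizationCumulant d (box d n) β (2 * k)| *
          ((2 * n + 2 : ℝ) ^ d * (2 * r + 1 : ℝ) ^ d) :=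
        mul_le_mul_of_nonneg_left hcardle (by positivity)
    _ = (2 * r + 1 : ℝ) ^ d * |magnetizationCumulant d (box d n) β (2 * k)| := by
        field_simp
    _ ≤ |magnetizationCumulant d (box d ((2 * n + 2) * r + n)) β (2 * k)| := hle

/-- A crude bound: `C^e ≤ max C 1` for `C ≥ 0` and `0 ≤ e ≤ 1`. [folklore] -/
theorem rpow_le_max_self_one {C e : ℝ} (hC : 0 ≤ C) (he0 : 0 ≤ e) (he1 : e ≤ 1) :
    C ^ e ≤ max C 1 := by
  rcases le_or_gt 1 C with h1 | h1
  · calc C ^ e ≤ C ^ (1 : ℝ) := Real.rpow_le_rpow_of_exponent_le h1 he1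
      _ = C := Real.rpow_one C
      _ ≤ max C 1 := le_max_left _ _
  · exact (Real.rpow_le_one hC h1.le he0).trans (le_max_right _ _)

/-- **JN (2.23): `1/lim_n α₁(B_n,β) ≤ limsup_k [|f_β^{(2k)}(0)|/(2k)!]^{1/(2k)}`, given CJN Theorem 1
and a positive limit** — for every `n`, `1/α₁(B_n,β) = limsup_k [|u_{2k}(M_{B_n})|/(2k)!]^{1/(2k)}`
(JN (2.22), `inv_firstZero_eq_limsup`) and `|u_{2k}(M_{B_n})| ≤ (2n+2)^d |f_β^{(2k)}(0)|`
(`abs_magnetizationCumulant_le_of_thm1`), the constant disappearing under the `2k`-th root.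
[cite: JiangNewman2023, Prop. 2, eq. (2.23)] -/
theorem inv_le_limsup_of_thm1 (h1 : CamiaJiangNewman2023_thm1) {β : ℝ} (hβ : 0 ≤ β)
    {a : ℝ} (hlim : Tendsto (fun n : ℕ => firstZero d (box d n) β) atTop (𝓝 a)) (ha : 0 < a) :
    a⁻¹ ≤ limsup (fun k : ℕ =>
      (|iteratedDeriv (2 * k) (freeEnergy d β) 0| / ((2 * k).factorial : ℝ)) ^ ((1 : ℝ) / (2 * k))) atTop := by
  set z : ℕ → ℝ := fun k =>
    (|iteratedDeriv (2 * k) (freeEnergy d β) 0| / ((2 * k).factorial : ℝ)) ^ ((1 : ℝ) / (2 * k)) with hz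
  have hz0 : ∀ k, 0 ≤ z k := fun k => Real.rpow_nonneg (by positivity) _
  -- `z` is bounded above (Cauchy-type bounds on the Taylor coefficients of `f_β`)
  have hzbdd : IsBoundedUnder (· ≤ ·) atTop z := by
    set r : ℝ := a / 3 with hr
    set R : ℝ := 2 * a / 3 with hR
    have hr0 : 0 < r := by rw [hr]; positivity
    have hrR : r < R := by rw [hr, hR]; linarith
    have hRa : R < a := by rw [hR]; linarith
    set C : ℝ := 2 * R * r / (R - r) with hC
    have hC0 : 0 < C := by rw [hC]; exact div_pos (by positivity) (by linarith)
    refine isBoundedUnder_of_eventually_le (a := max C 1 * r⁻¹) ?_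
    filter_upwards [eventually_ge_atTop 1] with k hk
    have h2k : 1 ≤ 2 * k := by omega
    have h2k0 : (2 * k : ℕ) ≠ 0 := by omega
    have hb := abs_iteratedDeriv_freeEnergy_div_le hβ hlim hr0 hrR hRa h2k
    have hexp : 0 ≤ (1 : ℝ) / (2 * k) := by positivity
    have hexp1 : (1 : ℝ) / (2 * k) ≤ 1 := by
      rw [div_le_one (by positivity)]
      have : (1 : ℝ) ≤ k := by exact_mod_cast hk
      linarith
    calc z k ≤ (C / r ^ (2 * k)) ^ ((1 : ℝ) / (2 * k)) := Real.rpow_le_rpow (by positivity) hb hexp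
      _ = C ^ ((1 : ℝ) / (2 * k)) * (r ^ (2 * k))⁻¹ ^ ((1 : ℝ) / (2 * k)) := by
          rw [div_eq_mul_inv, Real.mul_rpow hC0.le (by positivity)]
      _ = C ^ ((1 : ℝ) / (2 * k)) * r⁻¹ := by
          congr 1
          rw [← inv_pow, show ((1 : ℝ) / (2 * k)) = ((2 * k : ℕ) : ℝ)⁻¹ by push_cast; ring]
          exact Real.pow_rpow_inv_natCast (inv_nonneg.2 hr0.le) h2k0
      _ ≤ max C 1 * r⁻¹ :=
          mul_le_mul_of_nonneg_right (rpow_le_max_self_one hC0.le hexp hexp1) (inv_nonneg.2 hr0.le)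
  -- for every `n`: `1/α₁(B_n) ≤ limsup z`
  have hmain : ∀ n : ℕ, (firstZero d (box d n) β)⁻¹ ≤ limsup z atTop := by
    intro n
    have hne := box_nonempty d n
    have hα0 : 0 < firstZero d (box d n) β := (firstZero_spec hβ hne).1
    set y : ℕ → ℝ := fun k => (|magnetizationCumulant d (box d n) β (2 * k)| /
      ((2 * k).factorial : ℝ)) ^ ((1 : ℝ) / (2 * k)) with hy
    have hy0 : ∀ k, 0 ≤ y k := fun k => Real.rpow_nonneg (by positivity) _
    have hyeq : (firstZero d (box d n) β)⁻¹ = limsup y atTop := inv_firstZero_eq_limsup hβ hne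
    have hybdd : IsBoundedUnder (· ≤ ·) atTop y :=
      isBoundedUnder_of_eventually_le
        (eventually_cumulantRoot_le hβ hne (half_pos hα0) (half_lt_self hα0))
    -- the constant `c = (2n+2)^{-d}` and `c^{1/(2k)} → 1`
    set c : ℝ := ((2 * n + 2 : ℝ) ^ d)⁻¹ with hc
    have hc0 : 0 < c := by rw [hc]; positivity
    have hcle : ∀ k : ℕ, 1 ≤ k → c ^ ((1 : ℝ) / (2 * k)) * y k ≤ z k := by
      intro k hk
      have hA := abs_magnetizationCumulant_le_of_thm1 h1 hβ hlim ha n hk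
      have hexp : 0 ≤ (1 : ℝ) / (2 * k) := by positivity
      have hfac : (0 : ℝ) < ((2 * k).factorial : ℝ) := by positivity
      calc c ^ ((1 : ℝ) / (2 * k)) * y k
          = (c * (|magnetizationCumulant d (box d n) β (2 * k)| / ((2 * k).factorial : ℝ))) ^
              ((1 : ℝ) / (2 * k)) := by
            rw [Real.mul_rpow hc0.le (by positivity)]
        _ ≤ z k := Real.rpow_le_rpow (by positivity)
            (by rw [← mul_div_assoc]; exact div_le_div_of_nonneg_right hA hfac.le) hexp
    have hexp0 : Tendsto (fun k : ℕ => (1 : ℝ) / (2 * k)) atTop (𝓝 0) := by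
      have h1' : Tendsto (fun k : ℕ => (2 : ℝ) * k) atTop atTop :=
        (tendsto_natCast_atTop_atTop (R := ℝ)).const_mul_atTop two_pos
      exact tendsto_const_nhds.div_atTop h1'
    have hck : Tendsto (fun k : ℕ => c ^ ((1 : ℝ) / (2 * k))) atTop (𝓝 1) := by
      have hcont : ContinuousAt (fun x : ℝ => c ^ x) 0 := Real.continuousAt_const_rpow hc0.ne'
      have := hcont.tendsto.comp hexp0
      rw [Real.rpow_zero] at this
      exact this
    -- for `ε ∈ (0,1)`: `(1-ε)/α₁(B_n) ≤ limsup z`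
    have hε : ∀ ε : ℝ, 0 < ε → ε < 1 → (1 - ε) * (firstZero d (box d n) β)⁻¹ ≤ limsup z atTop := by
      intro ε hε0 hε1
      have h1ε : 0 ≤ 1 - ε := by linarith
      have hev : ∀ᶠ k in atTop, (1 - ε) * y k ≤ z k := by
        have h := hck.eventually (eventually_gt_nhds (show 1 - ε < 1 by linarith))
        filter_upwards [h, eventually_ge_atTop 1] with k hk hk1
        exact (mul_le_mul_of_nonneg_right hk.le (hy0 k)).trans (hcle k hk1)
      have hmap : (1 - ε) * limsup y atTop = limsup (fun k => (1 - ε) * y k) atTop := by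
        have hmono : Monotone (fun x : ℝ => (1 - ε) * x) := fun u v huv =>
          mul_le_mul_of_nonneg_left huv h1ε
        exact hmono.map_limsup_of_continuousAt y (continuous_const.mul continuous_id).continuousAt
          hybdd (isCoboundedUnder_le_of_le atTop hy0)
      rw [hyeq, hmap]
      exact limsup_le_limsup hev (isCoboundedUnder_le_of_le atTop fun k => mul_nonneg h1ε (hy0 k)) hzbdd
    -- `ε → 0`
    have hεj : Tendsto (fun j : ℕ => (1 - (1 / ((j : ℝ) + 1)) / 2) * (firstZero d (box d n) β)⁻¹)
        atTop (𝓝 ((1 - 0 / 2) * (firstZero d (box d n) β)⁻¹)) :=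
      (tendsto_const_nhds.sub (tendsto_one_div_add_atTop_nhds_zero_nat.div_const 2)).mul_const _
    rw [zero_div, sub_zero, one_mul] at hεj
    refine le_of_tendsto' hεj fun j => hε _ (by positivity) ?_
    have hj1 : 1 / ((j : ℝ) + 1) ≤ 1 := by
      rw [div_le_one (by positivity)]
      have : (0 : ℝ) ≤ j := Nat.cast_nonneg j
      linarith
    linarith
  -- `n → ∞`
  have hinv : Tendsto (fun n : ℕ => (firstZero d (box d n) β)⁻¹) atTop (𝓝 a⁻¹) := hlim.inv₀ ha.ne'
  exact le_of_tendsto' hinv hmain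

/-- **No holomorphic extension of `f_β` beyond the limit of the first zeros, given CJN Theorem 1
and a positive limit**: if `α₁(B_n,β) → a > 0` then `f_β` extends to no disc `|h| < ρ` with `ρ > a`
(else Cauchy's estimates give `limsup_k [|f_β^{(2k)}(0)|/(2k)!]^{1/(2k)} ≤ 1/ρ' < 1/a` for
`a < ρ' < ρ`, against `inv_le_limsup_of_thm1`). [cite: JiangNewman2023, Thm. 1 with Prop. 3] -/
theorem not_analyticOnDisc_of_thm1 (h1 : CamiaJiangNewman2023_thm1) {β : ℝ} (hβ : 0 ≤ β)
    {a : ℝ} (hlim : Tendsto (fun n : ℕ => firstZero d (box d n) β) atTop (𝓝 a)) (ha : 0 < a)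
    {ρ : ℝ} (hρ : a < ρ) : ¬ AnalyticOnDisc d β ρ := by
  rintro ⟨F, hF, hFre⟩
  have hρ0 : 0 < ρ := ha.trans hρ
  set z : ℕ → ℝ := fun k =>
    (|iteratedDeriv (2 * k) (freeEnergy d β) 0| / ((2 * k).factorial : ℝ)) ^ ((1 : ℝ) / (2 * k)) with hz
  have hz0 : ∀ k, 0 ≤ z k := fun k => Real.rpow_nonneg (by positivity) _
  have hL : a⁻¹ ≤ limsup z atTop := inv_le_limsup_of_thm1 h1 hβ hlim ha
  obtain ⟨ρ', hρ'1, hρ'2⟩ := exists_between hρ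
  obtain ⟨ρ'', hρ''1, hρ''2⟩ := exists_between hρ'1
  have hρ'0 : 0 < ρ' := ha.trans hρ'1
  have hρ''0 : 0 < ρ'' := ha.trans hρ''1
  -- Cauchy's estimates on the circle of radius `ρ'`
  have hsph : Metric.sphere (0 : ℂ) ρ' ⊆ Metric.ball 0 ρ :=
    Metric.sphere_subset_closedBall.trans (Metric.closedBall_subset_ball hρ'2)
  obtain ⟨M, hM⟩ : ∃ M, ∀ w ∈ Metric.sphere (0 : ℂ) ρ', ‖F w‖ ≤ M :=
    (isCompact_sphere (0 : ℂ) ρ').exists_bound_of_continuousOn (hF.continuousOn.mono hsph)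
  set M' : ℝ := max M 1 with hM'
  have hM'0 : 0 < M' := lt_max_of_lt_right one_pos
  have hM'b : ∀ w ∈ Metric.sphere (0 : ℂ) ρ', ‖F w‖ ≤ M' := fun w hw => (hM w hw).trans (le_max_left _ _)
  have hdc : DiffContOnCl ℂ F (Metric.ball 0 ρ') := by
    refine DifferentiableOn.diffContOnCl ?_
    rw [closure_ball _ hρ'0.ne']
    exact hF.mono (Metric.closedBall_subset_ball hρ'2)
  have hcauchy : ∀ m, ‖iteratedDeriv m F 0‖ ≤ (m.factorial : ℝ) * M' / ρ' ^ m := fun m =>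
    Complex.norm_iteratedDeriv_le_of_forall_mem_sphere_norm_le m hρ'0 hdc hM'b
  -- the derivatives of `f_β` at `0` are the real parts of those of `F`
  have hder : ∀ m, iteratedDeriv m (freeEnergy d β) 0 = (iteratedDeriv m F 0).re := by
    intro m
    have h1' := iteratedDeriv_re_ofReal_eq hF m (t := 0) (by simpa using hρ0)
    have heq : (fun s : ℝ => (F s).re) =ᶠ[𝓝 0] freeEnergy d β := by
      have hS : {s : ℝ | |s| < ρ} ∈ 𝓝 (0 : ℝ) :=
        (isOpen_lt continuous_abs continuous_const).mem_nhds (by simpa using hρ0)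
      filter_upwards [hS] with s hs
      rw [hFre s hs, Complex.ofReal_re]
    rw [← heq.iteratedDeriv_eq m, h1', Complex.ofReal_zero]
  -- hence `z m ≤ M'^{1/(2m)}/ρ'` for `m ≥ 1`
  have hzle : ∀ m : ℕ, 1 ≤ m → z m ≤ M' ^ ((1 : ℝ) / (2 * m)) * ρ'⁻¹ := by
    intro m hm
    have h2m0 : (2 * m : ℕ) ≠ 0 := by omega
    have hfac : (0 : ℝ) < ((2 * m).factorial : ℝ) := by positivity
    have hb : |iteratedDeriv (2 * m) (freeEnergy d β) 0| / ((2 * m).factorial : ℝ) ≤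
        M' / ρ' ^ (2 * m) := by
      rw [hder, div_le_iff₀ hfac]
      calc |(iteratedDeriv (2 * m) F 0).re| ≤ ‖iteratedDeriv (2 * m) F 0‖ := Complex.abs_re_le_norm _
        _ ≤ ((2 * m).factorial : ℝ) * M' / ρ' ^ (2 * m) := hcauchy (2 * m)
        _ = M' / ρ' ^ (2 * m) * ((2 * m).factorial : ℝ) := by ring
    calc z m ≤ (M' / ρ' ^ (2 * m)) ^ ((1 : ℝ) / (2 * m)) :=
          Real.rpow_le_rpow (by positivity) hb (by positivity)
      _ = M' ^ ((1 : ℝ) / (2 * m)) * (ρ' ^ (2 * m))⁻¹ ^ ((1 : ℝ) / (2 * m)) := by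
          rw [div_eq_mul_inv, Real.mul_rpow hM'0.le (by positivity)]
      _ = M' ^ ((1 : ℝ) / (2 * m)) * ρ'⁻¹ := by
          congr 1
          rw [← inv_pow, show ((1 : ℝ) / (2 * m)) = ((2 * m : ℕ) : ℝ)⁻¹ by push_cast; ring]
          exact Real.pow_rpow_inv_natCast (inv_nonneg.2 hρ'0.le) h2m0
  -- `M'^{1/(2m)} → 1`, so eventually `z m ≤ 1/ρ''`
  have hexp0 : Tendsto (fun m : ℕ => (1 : ℝ) / (2 * m)) atTop (𝓝 0) := by
    have h1' : Tendsto (fun m : ℕ => (2 : ℝ) * m) atTop atTop :=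
      (tendsto_natCast_atTop_atTop (R := ℝ)).const_mul_atTop two_pos
    exact tendsto_const_nhds.div_atTop h1'
  have hMk : Tendsto (fun m : ℕ => M' ^ ((1 : ℝ) / (2 * m))) atTop (𝓝 1) := by
    have hcont : ContinuousAt (fun x : ℝ => M' ^ x) 0 := Real.continuousAt_const_rpow hM'0.ne'
    have := hcont.tendsto.comp hexp0
    rw [Real.rpow_zero] at this
    exact this
  have hwk : Tendsto (fun m : ℕ => M' ^ ((1 : ℝ) / (2 * m)) * ρ'⁻¹) atTop (𝓝 (1 * ρ'⁻¹)) :=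
    hMk.mul_const _
  rw [one_mul] at hwk
  have hlt : ρ'⁻¹ < ρ''⁻¹ := (inv_lt_inv₀ hρ'0 hρ''0).2 hρ''2
  have hev : ∀ᶠ m in atTop, z m ≤ ρ''⁻¹ := by
    filter_upwards [hwk.eventually (eventually_lt_nhds hlt), eventually_ge_atTop 1] with m hm hm1
    exact (hzle m hm1).trans hm.le
  have hlimsup : limsup z atTop ≤ ρ''⁻¹ := limsup_le_of_le (isCoboundedUnder_le_of_le atTop hz0) hev
  have hlt' : ρ''⁻¹ < a⁻¹ := (inv_lt_inv₀ hρ''0 ha).2 hρ''1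
  linarith

/-- **`FirstZeroLimit` from Camia–Jiang–Newman 2023, Theorem 1, and the positivity of the limit of
the first zeros below `β_c`.** Of the three residual inputs of `firstZeroLimit_of_residual`, the
antitonicity (i) is CJN Thm 2 (`antitone_firstZero_of_CJN`), itself CJN Thm 1 by the tree's
`CamiaJiangNewman2023_thm2_of_thm1`; the direction (2.23) and the non-extension beyond `a` (iii)
are `inv_le_limsup_of_thm1` and `not_analyticOnDisc_of_thm1` above. What remains besides the
named fact `CamiaJiangNewman2023_thm1` is (ii): for `d ≥ 2` and `0 ≤ β < β_c(d)` the limit of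
`α₁(B_n, β)` is positive — Jiang–Newman's Corollary 1 (the uniform zero-free disc), which in the
printed proof comes from the analyticity of `f_β` at `h = 0` for `β < β_c` [Ott 2020, Cor. 1.4]
together with Lebowitz 1972 / Aizenman–Barsky–Fernández 1987 (JN Theorem 2); neither is in the tree.
[cite: JiangNewman2023, Thm. 1, Props. 1–3, Lemma 1, Cor. 1] -/
theorem firstZeroLimit_of_thm1_of_pos (h1 : CamiaJiangNewman2023_thm1)
    (hpos : ∀ d : ℕ, 2 ≤ d → ∀ β : ℝ, 0 ≤ β → β < criticalBeta d → ∀ a : ℝ,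
      Tendsto (fun n : ℕ => firstZero d (box d n) β) atTop (𝓝 a) → 0 < a) :
    FirstZeroLimit :=
  firstZeroLimit_of_CJN_of_residual (CamiaJiangNewman2023_thm2_of_thm1 h1) hpos
    fun d hd β hβ hβc a hlim =>
      ⟨fun _ hρ => not_analyticOnDisc_of_thm1 h1 hβ hlim (hpos d hd β hβ hβc a hlim) hρ,
        inv_le_limsup_of_thm1 h1 hβ hlim (hpos d hd β hβ hβc a hlim)⟩

end Subcritical

/-! ### The printed dependencies: `FirstZeroLimit` from CJN Thm 1, the analyticity of `f_β` at `0` and the convergence of the cumulant densities -/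

section PrintedInputs

/-- **`(2n+2)^{-d} |u_{2k}(M_{B_n,β,0})| ≤ |lim_m u_{2k}(M_{B_m,β,0})/|B_m||`, given CJN Theorem 1**
and the mere EXISTENCE of the limit of the cumulant densities (JN (2.9): the box `B_{(2n+2)r+n}`
contains `(2r+1)^d` separated translates of `B_n`). [cite: JiangNewman2023, Prop. 1 (proof, eq. (2.9))] -/
theorem abs_magnetizationCumulant_le_of_tendsto (h1 : CamiaJiangNewman2023_thm1) {β : ℝ}
    (hβ : 0 ≤ β) {k : ℕ} (hk : 1 ≤ k) {T : ℝ}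
    (hT : Tendsto (fun m : ℕ => magnetizationCumulant d (box d m) β (2 * k) / (#(box d m) : ℝ))
      atTop (𝓝 T)) (n : ℕ) :
    ((2 * n + 2 : ℝ) ^ d)⁻¹ * |magnetizationCumulant d (box d n) β (2 * k)| ≤ |T| := by
  have hm : Tendsto (fun r : ℕ => (2 * n + 2) * r + n) atTop atTop := by
    refine tendsto_atTop_mono (fun r => ?_) tendsto_id
    show r ≤ (2 * n + 2) * r + n
    nlinarith
  refine ge_of_tendsto' ((hT.comp hm).abs) fun r => ?_
  have hle := card_mul_abs_magnetizationCumulant_le_of_thm1 h1 hβ n r hk (d := d)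
  push_cast at hle
  have hpos : (0 : ℝ) < #(box d ((2 * n + 2) * r + n)) :=
    Nat.cast_pos.2 (Finset.card_pos.2 (box_nonempty d _))
  have hnat : (2 * ((2 * n + 2) * r + n) + 1) ^ d ≤ ((2 * n + 2) * (2 * r + 1)) ^ d :=
    Nat.pow_le_pow_left (by nlinarith) d
  have hcardle : (#(box d ((2 * n + 2) * r + n)) : ℝ) ≤ (2 * n + 2 : ℝ) ^ d * (2 * r + 1 : ℝ) ^ d := by
    rw [card_box, ← mul_pow]
    exact_mod_cast hnat
  have hn0 : (0 : ℝ) < (2 * n + 2 : ℝ) ^ d := by positivity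
  rw [Function.comp_apply, abs_div, Nat.abs_cast, le_div_iff₀ hpos]
  calc ((2 * n + 2 : ℝ) ^ d)⁻¹ * |magnetizationCumulant d (box d n) β (2 * k)| *
        (#(box d ((2 * n + 2) * r + n)) : ℝ)
      ≤ ((2 * n + 2 : ℝ) ^ d)⁻¹ * |magnetizationCumulant d (box d n) β (2 * k)| *
          ((2 * n + 2 : ℝ) ^ d * (2 * r + 1 : ℝ) ^ d) :=
        mul_le_mul_of_nonneg_left hcardle (by positivity)
    _ = (2 * r + 1 : ℝ) ^ d * |magnetizationCumulant d (box d n) β (2 * k)| := by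
        field_simp
    _ ≤ |magnetizationCumulant d (box d ((2 * n + 2) * r + n)) β (2 * k)| := hle

/-- **The uniform zero-free disc (Jiang–Newman Cor. 1) from the printed inputs**: given CJN
Theorem 1, if `f_β` extends holomorphically to `|h| < ρ` [Ott 2020, Cor. 1.4, for `β < β_c`] and
the even cumulant densities `u_{2k}(M_{B_m,β,0})/|B_m|` converge to `f_β^{(2k)}(0)` [JN Thm. 2 =
Lebowitz 1972 + Aizenman–Barsky–Fernández 1987, with Prop. 1: eq. (2.21)], then `α₁(B_n, β) ≥ ρ`
for EVERY `n` (JN Prop. 3 with (2.23): `α₁(B_n) ≥ r(β) ≥ ρ`; Cauchy's estimates for the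
extension bound `|f_β^{(2k)}(0)| ≤ (2k)! M ρ'^{-2k}`, and `1/α₁(B_n) = limsup_k [|u_{2k}(M_{B_n})|/(2k)!]^{1/(2k)}`).
[cite: JiangNewman2023, Prop. 3 and Cor. 1] -/
theorem le_firstZero_of_thm1_of_analyticOnDisc (h1 : CamiaJiangNewman2023_thm1) {β : ℝ} (hβ : 0 ≤ β)
    {ρ : ℝ} (hρ : 0 < ρ) (hA : AnalyticOnDisc d β ρ)
    (hT : ∀ k : ℕ, 1 ≤ k → Tendsto (fun m : ℕ => magnetizationCumulant d (box d m) β (2 * k) /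
      (#(box d m) : ℝ)) atTop (𝓝 (iteratedDeriv (2 * k) (freeEnergy d β) 0)))
    (n : ℕ) : ρ ≤ firstZero d (box d n) β := by
  obtain ⟨F, hF, hFre⟩ := hA
  have hne := box_nonempty d n
  have hα0 : 0 < firstZero d (box d n) β := (firstZero_spec hβ hne).1
  -- the derivatives of `f_β` at `0` are the real parts of those of `F`
  have hder : ∀ m, iteratedDeriv m (freeEnergy d β) 0 = (iteratedDeriv m F 0).re := by
    intro m
    have h1' := iteratedDeriv_re_ofReal_eq hF m (t := 0) (by simpa using hρ)
    have heq : (fun s : ℝ => (F s).re) =ᶠ[𝓝 0] freeEnergy d β := by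
      have hS : {s : ℝ | |s| < ρ} ∈ 𝓝 (0 : ℝ) :=
        (isOpen_lt continuous_abs continuous_const).mem_nhds (by simpa using hρ)
      filter_upwards [hS] with s hs
      rw [hFre s hs, Complex.ofReal_re]
    rw [← heq.iteratedDeriv_eq m, h1', Complex.ofReal_zero]
  -- `1/α₁(B_n) = limsup v`
  set v : ℕ → ℝ := fun k => (|magnetizationCumulant d (box d n) β (2 * k)| /
    ((2 * k).factorial : ℝ)) ^ ((1 : ℝ) / (2 * k)) with hv
  have hv0 : ∀ k, 0 ≤ v k := fun k => Real.rpow_nonneg (by positivity) _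
  have hveq : (firstZero d (box d n) β)⁻¹ = limsup v atTop := inv_firstZero_eq_limsup hβ hne
  -- it suffices to prove `α₁(B_n) ≥ ρ₁` for every `ρ₁ < ρ`
  refine le_of_forall_lt_imp_le_of_dense fun ρ₁ hρ₁ => ?_
  rcases le_or_gt ρ₁ 0 with hρ₁0 | hρ₁0
  · exact hρ₁0.trans hα0.le
  obtain ⟨ρ', hρ'1, hρ'2⟩ := exists_between hρ₁
  have hρ'0 : 0 < ρ' := hρ₁0.trans hρ'1
  -- Cauchy's estimates on the circle of radius `ρ'`
  have hsph : Metric.sphere (0 : ℂ) ρ' ⊆ Metric.ball 0 ρ :=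
    Metric.sphere_subset_closedBall.trans (Metric.closedBall_subset_ball hρ'2)
  obtain ⟨M, hM⟩ : ∃ M, ∀ w ∈ Metric.sphere (0 : ℂ) ρ', ‖F w‖ ≤ M :=
    (isCompact_sphere (0 : ℂ) ρ').exists_bound_of_continuousOn (hF.continuousOn.mono hsph)
  set M' : ℝ := max M 1 with hM'
  have hM'0 : 0 < M' := lt_max_of_lt_right one_pos
  have hM'b : ∀ w ∈ Metric.sphere (0 : ℂ) ρ', ‖F w‖ ≤ M' := fun w hw => (hM w hw).trans (le_max_left _ _)
  have hdc : DiffContOnCl ℂ F (Metric.ball 0 ρ') := by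
    refine DifferentiableOn.diffContOnCl ?_
    rw [closure_ball _ hρ'0.ne']
    exact hF.mono (Metric.closedBall_subset_ball hρ'2)
  have hcauchy : ∀ m, ‖iteratedDeriv m F 0‖ ≤ (m.factorial : ℝ) * M' / ρ' ^ m := fun m =>
    Complex.norm_iteratedDeriv_le_of_forall_mem_sphere_norm_le m hρ'0 hdc hM'b
  -- the constant `K = (2n+2)^d M'` and `v k ≤ K^{1/(2k)}/ρ'`
  set K : ℝ := (2 * n + 2 : ℝ) ^ d * M' with hK
  have hK0 : 0 < K := by rw [hK]; positivity
  have hvle : ∀ k : ℕ, 1 ≤ k → v k ≤ K ^ ((1 : ℝ) / (2 * k)) * ρ'⁻¹ := by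
    intro k hk
    have h2k0 : (2 * k : ℕ) ≠ 0 := by omega
    have hfac : (0 : ℝ) < ((2 * k).factorial : ℝ) := by positivity
    have hn0 : (0 : ℝ) < (2 * n + 2 : ℝ) ^ d := by positivity
    -- `|u_{2k}(B_n)| ≤ (2n+2)^d |f^{(2k)}(0)| ≤ (2n+2)^d (2k)! M'/ρ'^{2k}`
    have hA := abs_magnetizationCumulant_le_of_tendsto h1 hβ hk (hT k hk) n
    have hf : |iteratedDeriv (2 * k) (freeEnergy d β) 0| ≤ ((2 * k).factorial : ℝ) * M' / ρ' ^ (2 * k) := by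
      rw [hder]
      exact (Complex.abs_re_le_norm _).trans (hcauchy (2 * k))
    have hu : |magnetizationCumulant d (box d n) β (2 * k)| / ((2 * k).factorial : ℝ) ≤
        K / ρ' ^ (2 * k) := by
      rw [div_le_iff₀ hfac]
      have h := (inv_mul_le_iff₀ hn0).1 (hA.trans hf)
      calc |magnetizationCumulant d (box d n) β (2 * k)|
          ≤ (2 * n + 2 : ℝ) ^ d * (((2 * k).factorial : ℝ) * M' / ρ' ^ (2 * k)) := h
        _ = K / ρ' ^ (2 * k) * ((2 * k).factorial : ℝ) := by rw [hK]; ring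
    calc v k ≤ (K / ρ' ^ (2 * k)) ^ ((1 : ℝ) / (2 * k)) :=
          Real.rpow_le_rpow (by positivity) hu (by positivity)
      _ = K ^ ((1 : ℝ) / (2 * k)) * (ρ' ^ (2 * k))⁻¹ ^ ((1 : ℝ) / (2 * k)) := by
          rw [div_eq_mul_inv, Real.mul_rpow hK0.le (by positivity)]
      _ = K ^ ((1 : ℝ) / (2 * k)) * ρ'⁻¹ := by
          congr 1
          rw [← inv_pow, show ((1 : ℝ) / (2 * k)) = ((2 * k : ℕ) : ℝ)⁻¹ by push_cast; ring]
          exact Real.pow_rpow_inv_natCast (inv_nonneg.2 hρ'0.le) h2k0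
  -- `K^{1/(2k)} → 1`, so eventually `v k ≤ 1/ρ₁`, whence `1/α₁(B_n) ≤ 1/ρ₁`
  have hexp0 : Tendsto (fun k : ℕ => (1 : ℝ) / (2 * k)) atTop (𝓝 0) := by
    have h1' : Tendsto (fun k : ℕ => (2 : ℝ) * k) atTop atTop :=
      (tendsto_natCast_atTop_atTop (R := ℝ)).const_mul_atTop two_pos
    exact tendsto_const_nhds.div_atTop h1'
  have hKk : Tendsto (fun k : ℕ => K ^ ((1 : ℝ) / (2 * k))) atTop (𝓝 1) := by
    have hcont : ContinuousAt (fun x : ℝ => K ^ x) 0 := Real.continuousAt_const_rpow hK0.ne'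
    have := hcont.tendsto.comp hexp0
    rw [Real.rpow_zero] at this
    exact this
  have hwk : Tendsto (fun k : ℕ => K ^ ((1 : ℝ) / (2 * k)) * ρ'⁻¹) atTop (𝓝 (1 * ρ'⁻¹)) :=
    hKk.mul_const _
  rw [one_mul] at hwk
  have hlt : ρ'⁻¹ < ρ₁⁻¹ := (inv_lt_inv₀ hρ'0 hρ₁0).2 hρ'1
  have hev : ∀ᶠ k in atTop, v k ≤ ρ₁⁻¹ := by
    filter_upwards [hwk.eventually (eventually_lt_nhds hlt), eventually_ge_atTop 1] with k hk hk1
    exact (hvle k hk1).trans hk.le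
  have hlimsup : limsup v atTop ≤ ρ₁⁻¹ := limsup_le_of_le (isCoboundedUnder_le_of_le atTop hv0) hev
  rw [← hveq] at hlimsup
  exact (inv_le_inv₀ hα0 hρ₁0).1 hlimsup

/-- **`FirstZeroLimit` from the three printed inputs of Jiang–Newman's proof**: Camia–Jiang–Newman
2023, Thm. 1 (the named fact `CamiaJiangNewman2023_thm1`); the analyticity of `f_β` at `h = 0` for
`0 ≤ β < β_c(d)` [Ott 2020, Cor. 1.4] (`hOtt`, in the vocabulary of the fact file: some disc
`|h| < ρ`, `ρ > 0`, carries a holomorphic extension); and the convergence of the even cumulant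
densities `u_{2k}(M_{B_m,β,0})/|B_m| → f_β^{(2k)}(0)` for `β < β_c(d)` [JN Thm. 2 = Lebowitz 1972 +
Aizenman–Barsky–Fernández 1987, with Prop. 1; eq. (2.21)] (`hLeb`). Everything else — Lee–Yang,
Friedli–Velenik Thm. 3.6, the divergence of `χ` at and above `β_c`, JN Props. 2–3, Lemma 1 and the
deduction of CJN Thm. 2 / Cor. 1 from Thm. 1 — is proved in the tree.
[cite: JiangNewman2023, Thm. 1, Props. 1–3, Thm. 2, Lemma 1, Cor. 1] -/
theorem firstZeroLimit_of_thm1_of_analytic_of_tendsto (h1 : CamiaJiangNewman2023_thm1)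
    (hOtt : ∀ d : ℕ, 2 ≤ d → ∀ β : ℝ, 0 ≤ β → β < criticalBeta d →
      ∃ ρ : ℝ, 0 < ρ ∧ AnalyticOnDisc d β ρ)
    (hLeb : ∀ d : ℕ, 2 ≤ d → ∀ β : ℝ, 0 ≤ β → β < criticalBeta d → ∀ k : ℕ, 1 ≤ k →
      Tendsto (fun m : ℕ => magnetizationCumulant d (box d m) β (2 * k) / (#(box d m) : ℝ)) atTop
        (𝓝 (iteratedDeriv (2 * k) (freeEnergy d β) 0))) :
    FirstZeroLimit :=
  firstZeroLimit_of_thm1_of_pos h1 fun d hd β hβ hβc a hlim => by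
    obtain ⟨ρ, hρ, hA⟩ := hOtt d hd β hβ hβc
    exact hρ.trans_le (ge_of_tendsto' hlim fun n =>
      le_firstZero_of_thm1_of_analyticOnDisc h1 hβ hρ hA (hLeb d hd β hβ hβc) n)

end PrintedInputs


end JiangNewman

end Literature.Probability.LatticeModels

end
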